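import Summits.QuantumFields.BalabanUV.Beta.GAN24.TableDressingDefect
import Summits.QuantumFields.BalabanUV.Beta.GAN24.CoDressedColumnPairing

/-!
# `BalabanUV.Beta.GAN24.SlotDefectWindowBound` — binder row G-an2-4 ∕ (CONV-C), CT-W, route of record «WC-TL» (the row owner gan24-p1 g24's
# RULING R-gan24p1-g24-1 ∕ -2, `gen24/CT-W-DESIGN-v2.md` v2.1 §3: `q_j − b̃_j = 𝒜^B_j ((𝔇 − 1) T̃_j) = Σ_{S ≠ ∅} 𝒜^B_j (D_S T̃_j)`, each one-slot factor
# `P_s Z − Z = −ι_s Δ_s Z`; journal INTENT [LEAF02-G53-ONLINE] «ι-WIN»):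
# **THE ONE-SLOT DRESSING DEFECTS ARE WINDOW PAIRINGS OF THE SLOT DIVERGENCES — POINTWISE WINDOW BOUNDS**
# `|(P_s Z − Z)(slot s at (α, q))| ≤ 2(d+1)N · Σ_{v ∈ [−N, N]^{d+1}} |(Δ_s Z)(q + v)|`, for the two source slots, the two kernel legs, and the
# `|S| = 2` source nest `P₁ (P₂ Y − Y) − (P₂ Y − Y)` (double window, DOUBLE slot divergence)

NOT IN PRINT; OUR BOOKKEEPING (G-an2-4 crux team (2), leaf prover `b2b-balaban-gan24-formalise-leaf-02`, gen 53).  [folklore] finite-window bookkeeping over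
an2's `bmGaugeAt` ∕ `cube` ∕ `coProjBmAt(K)` ∕ `legCo₁∕₂BmAt`, this lineage's `CoProjBmDivFree.sub_mem_cube_of_bmGaugeAt_ne_zero` (the potential `φ_{α,q}` lives in
the window `q + [−N, N]^{d+1}`) and `CoDressedColumnPairing.abs_bmGaugeAt_le` (`|φ_{α,q}| ≤ 2(d+1)N`), and leaf-06 g43's `TableDressingDefect.coProjBmAt_sub_self_apply`
(`(Πᵀ_bm − 1) g = Σ' φ · div g`), all BY NAME; generic dimension `d + 1`, in-block root `ρ = toSite r`, `r ∈ box (d+1) N`, `1 ≤ N`; NO decay hypothesis anywhere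
(every statement holds for ANY table ∕ kernel); 0 `def`, 0 cited facts, 0 `def … : Prop`, 0 sorry.
HONEST FRAMING (cell contract, verbatim): «discharging `BetaPertH` makes Bałaban's UV stability UNCONDITIONAL — a real constructive-QFT result; it is NOT the
continuum limit and NOT the Clay problem.»  HONEST DEPENDENCY (verbatim): «continuum YM on T⁴ ⇐ BetaPertH ∧ nine spine estimates (0/9 proved); BetaPertH ⇐
(D1) ∧ (D4) ∧ CAP+tail; G-an2-4 gates asym, D1 and NE2/3/4.»

## Why (WC-TL's row (H) ∕ (Q), member-free)
leaf-06's `TableDressingDefect.locStencil₂_tableDress_sub_self` bounds `𝔇 X − X` by the constant OF `X` — for `X = T̃_j` that is the member, whose uniform bound is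
the goal «T2Shape» (the owner's K-TL-1 caveat: circularity).  The route of record bounds the forcing `q_j` through the SLAVED slot divergences `Δ_S T̃_j`
(SLAVE-src `T2SlavedDivergence`: level-`j` first-order data, no member).  This module is the OPERATOR half of that step for the pure-source terms: each defect is
controlled by a finite window sum of the slot divergence it pairs with, with the displayed constant `2(d+1)N` per slot — so a decay class on `Δ_S T̃_j` transfers
to `D_S T̃_j` with the window's harmless `(2N+1)^{d+1} e^{O(δ N)}` (the `LocStencil₂` corollaries are PART 2 of this INTENT).  The leg defects (§2) are typed for
(Q-L) under either exit; their divergences are NOT slaved today (RULING R-gan24p1-g24-2: (Q-L) OPEN).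

## What (all entrywise at a kernel entry `x z a b`; `div g p := Σ_β (g β p − g β (p − e_β))`; `divV` = `KernelWard.divV`, `divV V y = Σ_μ (V μ (y − e_μ) − V μ y)` —
## the letter of D1's table laws and of SLAVE-src; `|div g p| = |divV g p|`)
* §0 `abs_bondIndCast_le`, `abs_phi_le` (`|φ_{α,q} p| ≤ 2(d+1)N`), `divV_apply` (entrywise unfolding in `AffineAveraging.unitVec`'s convention — the tree's
  `WardLocusStencils.divV_apply` ∕ `MixedWardPackingFF.divV_apply` are the `B6BondElimination.unitVec` twins), `abs_div_eq_abs_divV`, `coProjBmAt_finset_sum_sub`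
  (additivity of the window operator over finite sums of differences).  D1's `divW Y y ν y′` IS `divV` of the first-slot section BY `rfl` — the tree's
  `WardLocusQuartic.divW_eq_divV` ∕ `D1BFx.CoProjDivergence.divW_eq_divV_fst` (not restated here): SLAVE-src's letter `divW (T♮̃_{j+1})` is the first-slot
  divergence §2 pairs with the window.
* §1 **`abs_coProjBmAt_sub_self_le`** — THE ONE-FORM CORE: `|coProjBmAt ρ N g α q − g α q| ≤ 2(d+1)N · Σ_{v ∈ cube (d+1) N} |div g (q + v)|`, ANY `g`.
* §2 THE FOUR SLOT INSTANCES (ANY table `Y : Tab d`, ANY kernel `V`): **`abs_coProj_fst_sub_self_le`** (first source slot, `divV (κ₁ u₁ ↦ Y κ₁ u₁ κ′ u′) (u + v)`),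
  **`abs_coProj_snd_sub_self_le`** (second source slot, `divV (κ₁ u₁ ↦ Y κ u κ₁ u₁) (u′ + v)`), `abs_legCo₁_sub_self_inl_le` ∕ `abs_legCo₂_sub_self_inl_le`
  (kernel legs, field components, by the window sums of the LEG divergences; the multiplier components are `0` — leaf-06's `legCo₁∕₂_sub_self_inr`).
* §3 THE `|S| = 2` SOURCE NEST of T-DL: `divV_fst_coProj_snd_sub_self` (`Δ₁ (P₂ Y − Y) = (Πᵀ_bm − 1)(Δ₁ Y)` in the second slot — `P₂` acts entrywise in the first
  slot) and **`abs_defect_fst_snd_le`**: `|(P₁ (P₂ Y − Y) − (P₂ Y − Y)) κ u κ′ u′ x z a b| ≤ (2(d+1)N)² · Σ_v Σ_{v′} |divV (κ₂ u₂ ↦ divV (κ₁ u₁ ↦ Y κ₁ u₁ κ₂ u₂) (u + v)) (u′ + v′) x z a b|`.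
Asserts NO value of any divergence of Bałaban's tables and NO estimate; discharges NOTHING of (H) ∕ (Q) ∕ (Q-R) ∕ (Q-L) ∕ «T2Shape» ∕ «T2Drift» ∕ (hW, hWall); 0 wall binders;
NEVER «G-an2-4 closed» as (CONV-C); NOT D1, NOT `BetaPertH`, NOT continuum, NOT Clay; not in print — our bookkeeping.
Unit `b2b-balaban-gan24-formalise-leaf-02` (gen 53), 2026-08-22.
-/

noncomputable section

open Finset
open scoped BigOperators
open Literature.MathematicalPhysics.QuantumFieldTheory
open Literature.MathematicalPhysics.QuantumFieldTheory.Balaban1983to89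
open Literature.MathematicalPhysics.QuantumFieldTheory.Balaban1983to89.Beta
open B12Sec2to5 (l1 l1_nonneg)
open ExpKernelCalculus (MKer Site)
open AffineAveraging (Form0 Form1 box toSite unitVec unitVec_apply)
open OneStepResolventKernel (Fib)
open KernelWard (divV)
open Summit.QuantumFields.BalabanUV.Beta.AxialProjectorBlockMean (bmGaugeAt)
open Summit.QuantumFields.BalabanUV.Beta.AxialDressingRooted (bondInd bondInd_apply abs_bondInd_le pmBm cube mem_cube card_cube coProjBmAt coProjBmAt_apply
  coProjBmAtK coProjBmAtK_eval legCo₁BmAt legCo₂BmAt legCo₁BmAt_inl legCo₂BmAt_inl)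
open Summit.QuantumFields.BalabanUV.Beta.GAN24.BiStencilZeroMode (Tab)
open Summit.QuantumFields.BalabanUV.Beta.GAN24.CoProjBmDivFree (sub_mem_cube_of_bmGaugeAt_ne_zero)
open Summit.QuantumFields.BalabanUV.Beta.GAN24.CoDressedColumnPairing (abs_bmGaugeAt_le)
open Summit.QuantumFields.BalabanUV.Beta.GAN24.TableDressingDefect (coProjBmAt_sub_self_apply)

namespace Summit.QuantumFields.BalabanUV.Beta.GAN24.SlotDefectWindowBound

variable {d : ℕ}

/-! ## §0 Letters: the potential's size, the divergence entrywise, additivity of the window operator -/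

/-- [folklore] `|(bondInd α q κ w : ℝ)| ≤ 1`. -/
theorem abs_bondIndCast_le (α : Fin (d + 1)) (q : Fin (d + 1) → ℤ) (κ : Fin (d + 1)) (w : Fin (d + 1) → ℤ) :
    |((bondInd α q κ w : ℤ) : ℝ)| ≤ 1 := by
  have h := abs_bondInd_le α q κ w
  rw [← Int.cast_abs]
  exact_mod_cast h

/-- [folklore] **THE BLOCK POTENTIAL OF A BOND INDICATOR IS BOUNDED BY `2(d+1)N`** (this lineage's `abs_bmGaugeAt_le` at `M = 1`; in-block root, `1 ≤ N`):
`|φ_{α,q} p| ≤ 2(d+1)N`, `φ_{α,q} := bmGaugeAt ρ δ_{(α,q)} N`. -/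
theorem abs_phi_le {N : ℕ} (hN : 1 ≤ N) {r : Fin (d + 1) → ℕ} (hr : r ∈ box (d + 1) N) (α : Fin (d + 1)) (q p : Fin (d + 1) → ℤ) :
    |bmGaugeAt (toSite r) (fun κ z => (bondInd α q κ z : ℝ)) N p| ≤ 2 * ((d : ℝ) + 1) * N := by
  have h := abs_bmGaugeAt_le hN hr (A := fun κ z => (bondInd α q κ z : ℝ)) (M := 1) (fun κ w => abs_bondIndCast_le α q κ w) p
  have e : (2 : ℝ) * ((((d + 1 : ℕ) : ℝ)) * N * 1) = 2 * ((d : ℝ) + 1) * N := by push_cast; ring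
  rw [e] at h
  exact h

/-- [folklore] `0 ≤ 2(d+1)N`. -/
theorem two_mul_nonneg (d N : ℕ) : (0 : ℝ) ≤ 2 * ((d : ℝ) + 1) * N := by positivity

/-- [folklore] **`divV` ENTRYWISE** (either unit-vector convention): `(divV V y) x z a b = Σ_μ (V μ (y − e_μ) x z a b − V μ y x z a b)`. -/
theorem divV_apply (V : Fin (d + 1) → (Fin (d + 1) → ℤ) → MKer (d + 1) (Fib d)) (y x z : Fin (d + 1) → ℤ) (a b : Fib d) :
    divV V y x z a b = ∑ μ : Fin (d + 1), (V μ (y - unitVec μ) x z a b - V μ y x z a b) := by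
  have e : ∀ μ : Fin (d + 1), (B6BondElimination.unitVec μ : Fin (d + 1) → ℤ) = unitVec μ := fun μ => by
    funext i
    simp only [B6BondElimination.unitVec, AffineAveraging.unitVec, Pi.single_apply]
  simp only [divV, Finset.sum_apply, Pi.sub_apply, e]

/-- [folklore] **THE DIVERGENCE IN EITHER ORIENTATION HAS THE SAME SIZE**: `|Σ_β (V β p − V β (p − e_β)) x z a b| = |(divV V p) x z a b|`. -/
theorem abs_div_eq_abs_divV (V : Fin (d + 1) → (Fin (d + 1) → ℤ) → MKer (d + 1) (Fib d)) (p x z : Fin (d + 1) → ℤ) (a b : Fib d) :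
    |∑ β : Fin (d + 1), (V β p x z a b - V β (p - unitVec β) x z a b)| = |divV V p x z a b| := by
  rw [divV_apply, ← abs_neg, ← Finset.sum_neg_distrib]
  congr 1
  exact Finset.sum_congr rfl fun β _ => by ring

/-- [folklore] **ADDITIVITY OF THE WINDOW OPERATOR OVER FINITE SUMS OF DIFFERENCES** (a finite double sum; ANY forms):
`coProjBmAt ρ N (Σ_{i ∈ s} (g₁ i − g₂ i)) α q = Σ_{i ∈ s} (coProjBmAt ρ N (g₁ i) α q − coProjBmAt ρ N (g₂ i) α q)`. -/
theorem coProjBmAt_finset_sum_sub {ι : Type*} (s : Finset ι) (ρ : Fin (d + 1) → ℤ) (N : ℕ) (g₁ g₂ : ι → Form1 (d + 1) ℝ) (α : Fin (d + 1))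
    (q : Fin (d + 1) → ℤ) :
    coProjBmAt ρ N (fun β p => ∑ i ∈ s, (g₁ i β p - g₂ i β p)) α q = ∑ i ∈ s, (coProjBmAt ρ N (g₁ i) α q - coProjBmAt ρ N (g₂ i) α q) := by
  have e : ∀ v ∈ cube (d + 1) N, ∑ β : Fin (d + 1), pmBm ρ N β (q + v) α q * ∑ i ∈ s, (g₁ i β (q + v) - g₂ i β (q + v))
      = ∑ i ∈ s, ∑ β : Fin (d + 1), (pmBm ρ N β (q + v) α q * g₁ i β (q + v) - pmBm ρ N β (q + v) α q * g₂ i β (q + v)) := by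
    intro v _
    rw [Finset.sum_comm]
    refine Finset.sum_congr rfl fun β _ => ?_
    rw [Finset.mul_sum]
    refine Finset.sum_congr rfl fun i _ => ?_
    ring
  rw [coProjBmAt_apply, Finset.sum_congr rfl e, Finset.sum_comm]
  refine Finset.sum_congr rfl fun i _ => ?_
  rw [coProjBmAt_apply, coProjBmAt_apply, ← Finset.sum_sub_distrib]
  refine Finset.sum_congr rfl fun v _ => ?_
  rw [← Finset.sum_sub_distrib]

/-! ## §1 The one-form core: the dressing defect of a slot is bounded by the window sum of the slot's divergence -/

section Core

variable {N : ℕ} {r : Fin (d + 1) → ℕ}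

/-- NOT IN PRINT; OUR BOOKKEEPING.  **THE ONE-FORM CORE** (in-block root, `1 ≤ N`, ANY `g`):
`|coProjBmAt ρ N g α q − g α q| ≤ 2(d+1)N · Σ_{v ∈ cube (d+1) N} |Σ_β (g β (q+v) − g β (q+v−e_β))|` — the defect `(Πᵀ_bm − 1) g = Σ'_p φ_{α,q} p · div g (p)`
(leaf-06's `coProjBmAt_sub_self_apply`) has its potential supported in the window `q + [−N, N]^{d+1}` (`sub_mem_cube_of_bmGaugeAt_ne_zero`) and bounded by `2(d+1)N`
(`abs_phi_le`). -/
theorem abs_coProjBmAt_sub_self_le (hN : 1 ≤ N) (hr : r ∈ box (d + 1) N) (g : Form1 (d + 1) ℝ) (α : Fin (d + 1)) (q : Fin (d + 1) → ℤ) :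
    |coProjBmAt (toSite r) N g α q - g α q|
      ≤ 2 * ((d : ℝ) + 1) * N * ∑ v ∈ cube (d + 1) N, |∑ β : Fin (d + 1), (g β (q + v) - g β (q + v - unitVec β))| := by
  rw [coProjBmAt_sub_self_apply hN hr]
  set φ : Form0 (d + 1) ℝ := bmGaugeAt (toSite r) (fun κ z => (bondInd α q κ z : ℝ)) N with hφ
  set W : Finset (Fin (d + 1) → ℤ) := (cube (d + 1) N).map (addLeftEmbedding q) with hW
  have hWmem : ∀ {p : Fin (d + 1) → ℤ}, p - q ∈ cube (d + 1) N → p ∈ W := by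
    intro p hp
    rw [hW, Finset.mem_map]
    exact ⟨p - q, hp, by simp [addLeftEmbedding]⟩
  have hs : ∀ p : Fin (d + 1) → ℤ, p ∉ W → φ p * ∑ β : Fin (d + 1), (g β p - g β (p - unitVec β)) = 0 := by
    intro p hp
    by_cases h : φ p = 0
    · rw [h, zero_mul]
    · exact absurd (hWmem (sub_mem_cube_of_bmGaugeAt_ne_zero hN hr α q h)) hp
  have e1 : ∑' p : Fin (d + 1) → ℤ, φ p * ∑ β : Fin (d + 1), (g β p - g β (p - unitVec β))
      = ∑ v ∈ cube (d + 1) N, φ (q + v) * ∑ β : Fin (d + 1), (g β (q + v) - g β (q + v - unitVec β)) := by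
    rw [tsum_eq_sum (s := W) (fun p hp => hs p hp), hW, Finset.sum_map]
    rfl
  rw [e1, Finset.mul_sum]
  refine (Finset.abs_sum_le_sum_abs _ _).trans (Finset.sum_le_sum fun v _ => ?_)
  rw [abs_mul]
  exact mul_le_mul_of_nonneg_right (abs_phi_le hN hr α q (q + v)) (abs_nonneg _)

/-- NOT IN PRINT; OUR BOOKKEEPING.  The core in `divV` letters for a kernel-valued slot read at an entry: for `V : Fin (d+1) → ℤ^{d+1} → MKer`,
`|coProjBmAt ρ N (κ₁ u₁ ↦ V κ₁ u₁ x z a b) α q − V α q x z a b| ≤ 2(d+1)N · Σ_{v ∈ cube} |(divV V (q + v)) x z a b|`. -/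
theorem abs_coProjBmAt_sub_self_le_divV (hN : 1 ≤ N) (hr : r ∈ box (d + 1) N) (V : Fin (d + 1) → (Fin (d + 1) → ℤ) → MKer (d + 1) (Fib d))
    (α : Fin (d + 1)) (q x z : Fin (d + 1) → ℤ) (a b : Fib d) :
    |coProjBmAt (toSite r) N (fun κ₁ u₁ => V κ₁ u₁ x z a b) α q - V α q x z a b|
      ≤ 2 * ((d : ℝ) + 1) * N * ∑ v ∈ cube (d + 1) N, |divV V (q + v) x z a b| := by
  have h := abs_coProjBmAt_sub_self_le hN hr (fun κ₁ u₁ => V κ₁ u₁ x z a b) α q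
  refine h.trans (le_of_eq ?_)
  congr 1
  exact Finset.sum_congr rfl fun v _ => abs_div_eq_abs_divV V (q + v) x z a b

end Core

/-! ## §2 The four slot instances (ANY table, ANY kernel — no decay hypothesis) -/

section Slots

variable {N : ℕ} {r : Fin (d + 1) → ℕ}

/-- NOT IN PRINT; OUR BOOKKEEPING.  **THE FIRST-SOURCE-SLOT DEFECT IS BOUNDED BY THE WINDOW SUM OF THE FIRST-SLOT DIVERGENCE** (in-block root, `1 ≤ N`,
ANY table `Y`): `|(P₁ Y − Y) κ u κ′ u′ x z a b| ≤ 2(d+1)N · Σ_{v ∈ cube (d+1) N} |(divV (κ₁ u₁ ↦ Y κ₁ u₁ κ′ u′) (u + v)) x z a b|`,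
`P₁ Y := fun κ u κ′ u′ ↦ coProjBmAtK ρ N (κ₁ u₁ ↦ Y κ₁ u₁ κ′ u′) κ u` (leaf-06's T-DL letter). -/
theorem abs_coProj_fst_sub_self_le (hN : 1 ≤ N) (hr : r ∈ box (d + 1) N) (Y : Tab d) (κ : Fin (d + 1)) (u : Fin (d + 1) → ℤ) (κ' : Fin (d + 1))
    (u' x z : Fin (d + 1) → ℤ) (a b : Fib d) :
    |((fun κ u κ' u' => coProjBmAtK (toSite r) N (fun κ₁ u₁ => Y κ₁ u₁ κ' u') κ u) - Y) κ u κ' u' x z a b|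
      ≤ 2 * ((d : ℝ) + 1) * N * ∑ v ∈ cube (d + 1) N, |divV (fun κ₁ u₁ => Y κ₁ u₁ κ' u') (u + v) x z a b| := by
  show |coProjBmAtK (toSite r) N (fun κ₁ u₁ => Y κ₁ u₁ κ' u') κ u x z a b - Y κ u κ' u' x z a b| ≤ _
  rw [coProjBmAtK_eval]
  exact abs_coProjBmAt_sub_self_le_divV hN hr (fun κ₁ u₁ => Y κ₁ u₁ κ' u') κ u x z a b

/-- NOT IN PRINT; OUR BOOKKEEPING.  **THE SECOND-SOURCE-SLOT DEFECT IS BOUNDED BY THE WINDOW SUM OF THE SECOND-SLOT DIVERGENCE** (in-block root, `1 ≤ N`,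
ANY table `X`): `|(P₂ X − X) κ u κ′ u′ x z a b| ≤ 2(d+1)N · Σ_{v ∈ cube (d+1) N} |(divV (κ₁ u₁ ↦ X κ u κ₁ u₁) (u′ + v)) x z a b|`,
`P₂ X := fun κ u ↦ coProjBmAtK ρ N (X κ u)`. -/
theorem abs_coProj_snd_sub_self_le (hN : 1 ≤ N) (hr : r ∈ box (d + 1) N) (X : Tab d) (κ : Fin (d + 1)) (u : Fin (d + 1) → ℤ) (κ' : Fin (d + 1))
    (u' x z : Fin (d + 1) → ℤ) (a b : Fib d) :
    |((fun κ u => coProjBmAtK (toSite r) N (X κ u)) - X) κ u κ' u' x z a b|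
      ≤ 2 * ((d : ℝ) + 1) * N * ∑ v ∈ cube (d + 1) N, |divV (fun κ₁ u₁ => X κ u κ₁ u₁) (u' + v) x z a b| := by
  show |coProjBmAtK (toSite r) N (X κ u) κ' u' x z a b - X κ u κ' u' x z a b| ≤ _
  rw [coProjBmAtK_eval]
  exact abs_coProjBmAt_sub_self_le_divV hN hr (fun κ₁ u₁ => X κ u κ₁ u₁) κ' u' x z a b

/-- NOT IN PRINT; OUR BOOKKEEPING.  **THE FIRST-KERNEL-LEG DEFECT, FIELD COMPONENT, IS BOUNDED BY THE WINDOW SUM OF THE LEG DIVERGENCE** (in-block root, `1 ≤ N`,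
ANY kernel `V`): `|(legCo₁BmAt ρ N V − V) x z (inl α) b| ≤ 2(d+1)N · Σ_{v ∈ cube} |Σ_β (V (x+v) z (inl β) b − V (x+v−e_β) z (inl β) b)|` (the leg's
divergence in the variable `x`; typed for (Q-L) under either exit — the leg divergences are NOT slaved today). -/
theorem abs_legCo₁_sub_self_inl_le (hN : 1 ≤ N) (hr : r ∈ box (d + 1) N) (V : MKer (d + 1) (Fib d)) (x z : Fin (d + 1) → ℤ) (α : Fin (d + 1)) (b : Fib d) :
    |(legCo₁BmAt (toSite r) N V - V) x z (Sum.inl α) b|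
      ≤ 2 * ((d : ℝ) + 1) * N * ∑ v ∈ cube (d + 1) N, |∑ β : Fin (d + 1), (V (x + v) z (Sum.inl β) b - V (x + v - unitVec β) z (Sum.inl β) b)| := by
  show |legCo₁BmAt (toSite r) N V x z (Sum.inl α) b - V x z (Sum.inl α) b| ≤ _
  rw [legCo₁BmAt_inl]
  exact abs_coProjBmAt_sub_self_le hN hr (fun α' x' => V x' z (Sum.inl α') b) α x

/-- NOT IN PRINT; OUR BOOKKEEPING.  **THE SECOND-KERNEL-LEG DEFECT, FIELD COMPONENT, IS BOUNDED BY THE WINDOW SUM OF THE LEG DIVERGENCE** (in-block root, `1 ≤ N`,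
ANY kernel `V`): `|(legCo₂BmAt ρ N V − V) x z a (inl β₀)| ≤ 2(d+1)N · Σ_{v ∈ cube} |Σ_β (V x (z+v) a (inl β) − V x (z+v−e_β) a (inl β))|`. -/
theorem abs_legCo₂_sub_self_inl_le (hN : 1 ≤ N) (hr : r ∈ box (d + 1) N) (V : MKer (d + 1) (Fib d)) (x z : Fin (d + 1) → ℤ) (a : Fib d) (β₀ : Fin (d + 1)) :
    |(legCo₂BmAt (toSite r) N V - V) x z a (Sum.inl β₀)|
      ≤ 2 * ((d : ℝ) + 1) * N * ∑ v ∈ cube (d + 1) N, |∑ β : Fin (d + 1), (V x (z + v) a (Sum.inl β) - V x (z + v - unitVec β) a (Sum.inl β))| := by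
  show |legCo₂BmAt (toSite r) N V x z a (Sum.inl β₀) - V x z a (Sum.inl β₀)| ≤ _
  rw [legCo₂BmAt_inl]
  exact abs_coProjBmAt_sub_self_le hN hr (fun β' y' => V x y' a (Sum.inl β')) β₀ z

end Slots

/-! ## §3 The `|S| = 2` source nest: `P₁ (P₂ Y − Y) − (P₂ Y − Y)` by the double window sum of the double slot divergence -/

section Nest

variable {N : ℕ} {r : Fin (d + 1) → ℕ}

/-- NOT IN PRINT; OUR BOOKKEEPING.  **`P₂` ACTS ENTRYWISE IN THE FIRST SLOT, SO `Δ₁ (P₂ Y − Y) = (Πᵀ_bm − 1)(Δ₁ Y)` IN THE SECOND SLOT** (any root offset, any `N`,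
ANY table): `(divV (κ₁ u₁ ↦ (P₂ Y − Y) κ₁ u₁ κ′ u′) p) x z a b = coProjBmAt ρ N G κ′ u′ − G κ′ u′` with `G κ₂ u₂ := (divV (κ₁ u₁ ↦ Y κ₁ u₁ κ₂ u₂) p) x z a b`
(finite sums through the finite window operator, `coProjBmAt_finset_sum_sub`). -/
theorem divV_fst_coProj_snd_sub_self (ρ : Fin (d + 1) → ℤ) (N : ℕ) (Y : Tab d) (p : Fin (d + 1) → ℤ) (κ' : Fin (d + 1)) (u' x z : Fin (d + 1) → ℤ)
    (a b : Fib d) :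
    divV (fun κ₁ u₁ => ((fun κ u => coProjBmAtK ρ N (Y κ u)) - Y) κ₁ u₁ κ' u') p x z a b
      = coProjBmAt ρ N (fun κ₂ u₂ => divV (fun κ₁ u₁ => Y κ₁ u₁ κ₂ u₂) p x z a b) κ' u'
        - divV (fun κ₁ u₁ => Y κ₁ u₁ κ' u') p x z a b := by
  have eG : (fun κ₂ u₂ => divV (fun κ₁ u₁ => Y κ₁ u₁ κ₂ u₂) p x z a b)
      = fun κ₂ u₂ => ∑ μ : Fin (d + 1), (Y μ (p - unitVec μ) κ₂ u₂ x z a b - Y μ p κ₂ u₂ x z a b) := by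
    funext κ₂ u₂
    exact divV_apply _ p x z a b
  rw [eG, coProjBmAt_finset_sum_sub, divV_apply, divV_apply, ← Finset.sum_sub_distrib]
  refine Finset.sum_congr rfl fun μ _ => ?_
  simp only [Pi.sub_apply, coProjBmAtK_eval]
  ring

/-- NOT IN PRINT; OUR BOOKKEEPING.  **THE `|S| = 2` SOURCE NEST OF T-DL IS BOUNDED BY THE DOUBLE WINDOW SUM OF THE DOUBLE SLOT DIVERGENCE** (in-block root, `1 ≤ N`,
ANY table `Y`): with `P₂ Y := fun κ u ↦ coProjBmAtK ρ N (Y κ u)`, `Z := P₂ Y − Y`, `P₁ Z := fun κ u κ′ u′ ↦ coProjBmAtK ρ N (κ₁ u₁ ↦ Z κ₁ u₁ κ′ u′) κ u`,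
`|(P₁ Z − Z) κ u κ′ u′ x z a b| ≤ (2(d+1)N)² · Σ_{v ∈ cube} Σ_{v′ ∈ cube} |(divV (κ₂ u₂ ↦ divV (κ₁ u₁ ↦ Y κ₁ u₁ κ₂ u₂) (u + v)) (u′ + v′)) x z a b|` —
§2 on the first slot of `Z`, `divV_fst_coProj_snd_sub_self`, then §1 on the second slot of the first-slot divergence. -/
theorem abs_defect_fst_snd_le (hN : 1 ≤ N) (hr : r ∈ box (d + 1) N) (Y : Tab d) (κ : Fin (d + 1)) (u : Fin (d + 1) → ℤ) (κ' : Fin (d + 1))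
    (u' x z : Fin (d + 1) → ℤ) (a b : Fib d) :
    |((fun κ u κ' u' => coProjBmAtK (toSite r) N (fun κ₁ u₁ => ((fun κ u => coProjBmAtK (toSite r) N (Y κ u)) - Y) κ₁ u₁ κ' u') κ u)
        - ((fun κ u => coProjBmAtK (toSite r) N (Y κ u)) - Y)) κ u κ' u' x z a b|
      ≤ (2 * ((d : ℝ) + 1) * N) ^ 2 * ∑ v ∈ cube (d + 1) N, ∑ v' ∈ cube (d + 1) N,
          |divV (fun κ₂ u₂ => divV (fun κ₁ u₁ => Y κ₁ u₁ κ₂ u₂) (u + v)) (u' + v') x z a b| := by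
  set Z : Tab d := (fun κ u => coProjBmAtK (toSite r) N (Y κ u)) - Y with hZ
  have h1 := abs_coProj_fst_sub_self_le hN hr Z κ u κ' u' x z a b
  have h3 : ∀ v ∈ cube (d + 1) N, |divV (fun κ₁ u₁ => Z κ₁ u₁ κ' u') (u + v) x z a b|
      ≤ 2 * ((d : ℝ) + 1) * N * ∑ v' ∈ cube (d + 1) N, |divV (fun κ₂ u₂ => divV (fun κ₁ u₁ => Y κ₁ u₁ κ₂ u₂) (u + v)) (u' + v') x z a b| := by
    intro v _
    rw [hZ, divV_fst_coProj_snd_sub_self]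
    exact abs_coProjBmAt_sub_self_le_divV hN hr (fun κ₂ u₂ => divV (fun κ₁ u₁ => Y κ₁ u₁ κ₂ u₂) (u + v)) κ' u' x z a b
  refine h1.trans ?_
  calc 2 * ((d : ℝ) + 1) * N * ∑ v ∈ cube (d + 1) N, |divV (fun κ₁ u₁ => Z κ₁ u₁ κ' u') (u + v) x z a b|
      ≤ 2 * ((d : ℝ) + 1) * N * ∑ v ∈ cube (d + 1) N, (2 * ((d : ℝ) + 1) * N
          * ∑ v' ∈ cube (d + 1) N, |divV (fun κ₂ u₂ => divV (fun κ₁ u₁ => Y κ₁ u₁ κ₂ u₂) (u + v)) (u' + v') x z a b|) :=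
        mul_le_mul_of_nonneg_left (Finset.sum_le_sum h3) (two_mul_nonneg d N)
    _ = _ := by rw [← Finset.mul_sum]; ring

end Nest

end Summit.QuantumFields.BalabanUV.Beta.GAN24.SlotDefectWindowBound

end
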